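import Summits.MatrixMultiplication.MatrixMultiplication.Theses.FourierTwoFamiliesModP
import Literature.Computability.AlgebraicComplexity.SimultaneousDoubleProduct
import Literature.NumberTheory.Sieve.GreenTao2008

/-!
# `PrimeLogDecay` (crux stmt-MatrixMultiplication-14310, route FourierTwoFamiliesModP):
# load-bearing hypotheses, explicit constants, and the translate-class packing bound

Negative-side support file of the crux disprover (cdisprove seat); everything `sorry`-free.

* `primeLogDecay_false_without_W` — with (W) dropped the statement is FALSE (one pair
  `A = B = ℤ/p`): any proof must use (W).
* `primeLogDecay_false_without_X` — with (X) dropped it is FALSE (one direct pair repeated):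
  any proof must use (X).
* `PrimeLogDecayWith c s₀` / `primeLogDecay_iff` — the crux with its constants exposed;
  `not_primeLogDecayWith_13_3` — the translate family at block size 3 in `ℤ/37` kills
  `(c, s₀) = (13, 3)`: `s₀` must grow with `c` (translates have density `≈ 1/s`, forcing
  `(log s)^c ≤ s` for every `s ≥ s₀`).  `not_primeLogDecayWith_of_blocks` + `blk_*` turn any
  `Fin`-parametrised configuration into a `decide`-able certificate against given constants.
* `card_translateClass_mul_le` — ONE TRANSLATE CLASS PACKS: if `A i = t i +ᵥ A₀`, `B i = u i +ᵥ B₀`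
  for `i ∈ S` in an SDPP family then `|S|·|A₀|·|B₀| ≤ |G|` ((X) with `j = i` makes the sets
  `u i + (A₀ + B₀)` pairwise disjoint, (W) makes `A₀ ⊕ B₀` direct).  So `K` block shapes give
  `n s² ≤ K|G|` (density `≤ K/s`): a counterexample to the crux needs `≥ s/(log s)^c` shapes —
  translates, digit/CRT cubes and every bounded-shape design are excluded a priori.
-/

namespace Summit.MatrixMultiplication.MatrixMultiplication.Theorems.PrimeLogDecay.Negative

open Summit.MatrixMultiplication.MatrixMultiplication.Theses.FourierTwoFamiliesModP

/-- `PrimeLogDecay` with the constants `c, s₀` exposed. -/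
def PrimeLogDecayWith (c : ℝ) (s₀ : ℕ) : Prop :=
  ∀ p : ℕ, p.Prime → ∀ (n s : ℕ) (A B : Fin n → Finset (ZMod p)), s₀ ≤ s →
    (∀ i : Fin n, (A i).card = s ∧ (B i).card = s) →
    (∀ i : Fin n, ∀ a ∈ A i, ∀ a' ∈ A i, ∀ b ∈ B i, ∀ b' ∈ B i, (a - a') + (b - b') = 0 → a = a' ∧ b = b') →
    (∀ i j k : Fin n, ∀ a ∈ A i, ∀ a' ∈ A j, ∀ b ∈ B j, ∀ b' ∈ B k, (a - a') + (b - b') = 0 → i = k) →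
    (n : ℝ) * (s : ℝ) * Real.log (s : ℝ) ^ c ≤ (p : ℝ)

/-- The crux with its constants exposed. -/
theorem primeLogDecay_iff : PrimeLogDecay ↔ ∃ c : ℝ, 0 < c ∧ ∃ s₀ : ℕ, PrimeLogDecayWith c s₀ :=
  Iff.rfl

/-! ## Load-bearing: (W) -/

/-- (W) is load-bearing: without it a single pair `A = B = ℤ/p` (n = 1, s = p; (X) is vacuous for
one index) has `n·s·(log s)^c = p·(log p)^c > p` as soon as `p ≥ 3`.  (A less degenerate witness
with `s² ≤ p`: `A_i = B_i = (2s−1)·i + [0, s)`, density `s/(2s−1) > 1/2`; not formalised.) -/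
theorem primeLogDecay_false_without_W : ¬ (∃ c : ℝ, 0 < c ∧ ∃ s₀ : ℕ, ∀ p : ℕ, p.Prime → ∀ (n s : ℕ) (A B : Fin n → Finset (ZMod p)), s₀ ≤ s →
    (∀ i : Fin n, (A i).card = s ∧ (B i).card = s) →
    (∀ i j k : Fin n, ∀ a ∈ A i, ∀ a' ∈ A j, ∀ b ∈ B j, ∀ b' ∈ B k, (a - a') + (b - b') = 0 → i = k) →
    (n : ℝ) * (s : ℝ) * Real.log (s : ℝ) ^ c ≤ (p : ℝ)) := by
  rintro ⟨c, hc, s₀, h⟩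
  obtain ⟨p, hp_ge, hp⟩ := Nat.exists_infinite_primes (max s₀ 3)
  haveI : NeZero p := ⟨hp.ne_zero⟩
  have hs₀ : s₀ ≤ p := le_trans (le_max_left _ _) hp_ge
  have h3 : (3 : ℝ) ≤ p := by exact_mod_cast le_trans (le_max_right _ _) hp_ge
  have hX : ∀ i j k : Fin 1, ∀ a ∈ (fun _ : Fin 1 => (Finset.univ : Finset (ZMod p))) i,
      ∀ a' ∈ (fun _ : Fin 1 => (Finset.univ : Finset (ZMod p))) j,
      ∀ b ∈ (fun _ : Fin 1 => (Finset.univ : Finset (ZMod p))) j,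
      ∀ b' ∈ (fun _ : Fin 1 => (Finset.univ : Finset (ZMod p))) k,
      (a - a') + (b - b') = 0 → i = k := fun i j k _ _ _ _ _ _ _ _ _ => Subsingleton.elim i k
  have hcard : ∀ i : Fin 1, ((fun _ : Fin 1 => (Finset.univ : Finset (ZMod p))) i).card = p ∧
      ((fun _ : Fin 1 => (Finset.univ : Finset (ZMod p))) i).card = p := fun i => by
    simp [Finset.card_univ, ZMod.card]
  have key := h p hp 1 p (fun _ => Finset.univ) (fun _ => Finset.univ) hs₀ hcard hX
  have hlog : 1 < Real.log (p : ℝ) := Literature.NumberTheory.Sieve.GreenTao2008.one_lt_log_of_three_le h3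
  have hpow : 1 < Real.log (p : ℝ) ^ c := Real.one_lt_rpow hlog hc
  have hppos : (0 : ℝ) < p := by linarith
  have : (p : ℝ) < (p : ℝ) * Real.log (p : ℝ) ^ c := lt_mul_of_one_lt_right hppos hpow
  push_cast at key
  linarith


/-! ## Bridge: `Fin`-parametrised configurations -/

section Bridge
variable {p n s : ℕ}

/-- the block parametrised by `f i`. -/
def blk (f : Fin n → Fin s → ZMod p) (i : Fin n) : Finset (ZMod p) := Finset.univ.image (f i)

/-- Membership in a parametrised block. -/
lemma mem_blk {f : Fin n → Fin s → ZMod p} {i : Fin n} {a : ZMod p} :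
    a ∈ blk f i ↔ ∃ t, f i t = a := by simp [blk]

/-- Parametrised blocks are balanced of size `s` when the parametrisations are injective. -/
lemma blk_card (f g : Fin n → Fin s → ZMod p)
    (hf : ∀ i : Fin n, ∀ t t' : Fin s, f i t = f i t' → t = t')
    (hg : ∀ i : Fin n, ∀ t t' : Fin s, g i t = g i t' → t = t') :
    ∀ i : Fin n, (blk f i).card = s ∧ (blk g i).card = s := fun i =>
  ⟨by simp [blk, Finset.card_image_of_injective _ (fun t t' h => hf i t t' h)],
   by simp [blk, Finset.card_image_of_injective _ (fun t t' h => hg i t t' h)]⟩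

/-- (W) for parametrised blocks from its `Fin`-level version. -/
lemma blk_W (f g : Fin n → Fin s → ZMod p)
    (hW : ∀ i : Fin n, ∀ t t' u u' : Fin s, f i t - f i t' + (g i u - g i u') = 0 → t = t' ∧ u = u') :
    ∀ i : Fin n, ∀ a ∈ blk f i, ∀ a' ∈ blk f i, ∀ b ∈ blk g i, ∀ b' ∈ blk g i,
      (a - a') + (b - b') = 0 → a = a' ∧ b = b' := by
  intro i a ha a' ha' b hb b' hb' h
  obtain ⟨t, rfl⟩ := mem_blk.1 ha
  obtain ⟨t', rfl⟩ := mem_blk.1 ha'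
  obtain ⟨u, rfl⟩ := mem_blk.1 hb
  obtain ⟨u', rfl⟩ := mem_blk.1 hb'
  obtain ⟨rfl, rfl⟩ := hW i t t' u u' h
  exact ⟨rfl, rfl⟩

/-- (X) for parametrised blocks from its `Fin`-level version. -/
lemma blk_X (f g : Fin n → Fin s → ZMod p)
    (hX : ∀ i j k : Fin n, ∀ t t' u u' : Fin s, f i t - f j t' + (g j u - g k u') = 0 → i = k) :
    ∀ i j k : Fin n, ∀ a ∈ blk f i, ∀ a' ∈ blk f j, ∀ b ∈ blk g j, ∀ b' ∈ blk g k,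
      (a - a') + (b - b') = 0 → i = k := by
  intro i j k a ha a' ha' b hb b' hb' h
  obtain ⟨t, rfl⟩ := mem_blk.1 ha
  obtain ⟨t', rfl⟩ := mem_blk.1 ha'
  obtain ⟨u, rfl⟩ := mem_blk.1 hb
  obtain ⟨u', rfl⟩ := mem_blk.1 hb'
  exact hX i j k t t' u u' h

/-- A parametrised configuration that passes the three `decide`-able checks contradicts
`PrimeLogDecayWith c s₀` as soon as `p < n·s·(log s)^c`. -/
lemma not_primeLogDecayWith_of_blocks {c : ℝ} {s₀ : ℕ} (hp : p.Prime) (hs : s₀ ≤ s)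
    (f g : Fin n → Fin s → ZMod p)
    (hf : ∀ i : Fin n, ∀ t t' : Fin s, f i t = f i t' → t = t')
    (hg : ∀ i : Fin n, ∀ t t' : Fin s, g i t = g i t' → t = t')
    (hW : ∀ i : Fin n, ∀ t t' u u' : Fin s, f i t - f i t' + (g i u - g i u') = 0 → t = t' ∧ u = u')
    (hX : ∀ i j k : Fin n, ∀ t t' u u' : Fin s, f i t - f j t' + (g j u - g k u') = 0 → i = k)
    (hlt : (p : ℝ) < (n : ℝ) * (s : ℝ) * Real.log (s : ℝ) ^ c) :
    ¬ PrimeLogDecayWith c s₀ := fun h =>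
  absurd (h p hp n s (blk f) (blk g) hs (blk_card f g hf hg) (blk_W f g hW) (blk_X f g hX))
    (not_le.2 hlt)

end Bridge

/-! ## Load-bearing: (X) -/

/-! ## (a′) Load-bearing analysis, continued: (X) -/

/-- the standard direct pair `A = [0, s)`, `B = s·[0, s)` (repeated in every block). -/
def lineA (p n s : ℕ) : Fin n → Fin s → ZMod p := fun _ t => ((t : ℕ) : ZMod p)
/-- see `lineA`. -/
def lineB (p n s : ℕ) : Fin n → Fin s → ZMod p := fun _ t => ((s * (t : ℕ) : ℕ) : ZMod p)

/-- `Nat.cast` into `ZMod p` is injective below `p`. -/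
lemma natCast_inj_of_lt {p a b : ℕ} (ha : a < p) (hb : b < p) :
    ((a : ZMod p) = (b : ZMod p) ↔ a = b) := by
  rw [ZMod.natCast_eq_natCast_iff', Nat.mod_eq_of_lt ha, Nat.mod_eq_of_lt hb]

/-- `A = [0,s)`, `B = s·[0,s)` is a direct pair in `ℤ/p` once `s² < p` (no wrap-around). -/
lemma line_W {p n s : ℕ} (hsp : s * s < p) :
    ∀ i : Fin n, ∀ t t' u u' : Fin s,
      lineA p n s i t - lineA p n s i t' + (lineB p n s i u - lineB p n s i u') = 0 → t = t' ∧ u = u' := by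
  intro i t t' u u' h
  have hbound : ∀ a b : Fin s, (a : ℕ) + s * (b : ℕ) < p := by
    intro a b
    have ha := a.isLt
    have hb := b.isLt
    calc (a : ℕ) + s * b < s + s * b := by omega
      _ = s * (b + 1) := by ring
      _ ≤ s * s := Nat.mul_le_mul_left s hb
      _ < p := hsp
  simp only [lineA, lineB] at h
  have h1 : (((t : ℕ) + s * (u : ℕ) : ℕ) : ZMod p) = (((t' : ℕ) + s * (u' : ℕ) : ℕ) : ZMod p) := by
    push_cast at h ⊢
    linear_combination h
  rw [natCast_inj_of_lt (hbound t u) (hbound t' u')] at h1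
  have hmod1 : ((t : ℕ) + s * u) % s = t := by
    rw [Nat.add_mul_mod_self_left, Nat.mod_eq_of_lt t.isLt]
  have hmod2 : ((t' : ℕ) + s * u') % s = t' := by
    rw [Nat.add_mul_mod_self_left, Nat.mod_eq_of_lt t'.isLt]
  have htt : (t : ℕ) = t' := by rw [← hmod1, ← hmod2, h1]
  refine ⟨Fin.ext htt, Fin.ext ?_⟩
  rw [htt] at h1
  have hs : 0 < s := by have := t.isLt; omega
  exact Nat.eq_of_mul_eq_mul_left hs (Nat.add_left_cancel h1)

/-- `lineA` is injective once `s < p`. -/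
lemma lineA_inj {p n s : ℕ} (hsp : s < p) :
    ∀ i : Fin n, ∀ t t' : Fin s, lineA p n s i t = lineA p n s i t' → t = t' := by
  intro i t t' h
  have ht := t.isLt
  have ht' := t'.isLt
  simp only [lineA] at h
  exact Fin.ext ((natCast_inj_of_lt (by omega) (by omega)).1 h)

/-- `lineB` is injective once `s² < p`. -/
lemma lineB_inj {p n s : ℕ} (hsp : s * s < p) :
    ∀ i : Fin n, ∀ t t' : Fin s, lineB p n s i t = lineB p n s i t' → t = t' := by
  intro i t t' h
  have ht : s * (t : ℕ) < p := lt_trans (Nat.mul_lt_mul_of_pos_left t.isLt (by have := t.isLt; omega)) hsp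
  have ht' : s * (t' : ℕ) < p := lt_trans (Nat.mul_lt_mul_of_pos_left t'.isLt (by have := t.isLt; omega)) hsp
  simp only [lineB] at h
  have := (natCast_inj_of_lt ht ht').1 h
  exact Fin.ext (Nat.eq_of_mul_eq_mul_left (by have := t.isLt; omega) this)

/-- (X) is load-bearing: without it nothing bounds the number of blocks — repeat ONE direct pair
(`A_i = [0,s)`, `B_i = s·[0,s)`, `s = max s₀ 3`, `p > s²` prime) `p + 1` times. -/
theorem primeLogDecay_false_without_X : ¬ (∃ c : ℝ, 0 < c ∧ ∃ s₀ : ℕ, ∀ p : ℕ, p.Prime → ∀ (n s : ℕ) (A B : Fin n → Finset (ZMod p)), s₀ ≤ s →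
    (∀ i : Fin n, (A i).card = s ∧ (B i).card = s) →
    (∀ i : Fin n, ∀ a ∈ A i, ∀ a' ∈ A i, ∀ b ∈ B i, ∀ b' ∈ B i, (a - a') + (b - b') = 0 → a = a' ∧ b = b') →
    (n : ℝ) * (s : ℝ) * Real.log (s : ℝ) ^ c ≤ (p : ℝ)) := by
  rintro ⟨c, hc, s₀, h⟩
  set s : ℕ := max s₀ 3 with hs_def
  have hs₀ : s₀ ≤ s := le_max_left _ _
  have hs3 : 3 ≤ s := le_max_right _ _
  obtain ⟨p, hp_ge, hp⟩ := Nat.exists_infinite_primes (s * s + 1)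
  have hsp : s * s < p := hp_ge
  have hsp' : s < p := lt_of_le_of_lt (Nat.le_mul_self s) hsp
  have key := h p hp (p + 1) s (blk (lineA p (p + 1) s)) (blk (lineB p (p + 1) s)) hs₀
    (blk_card _ _ (lineA_inj hsp') (lineB_inj hsp)) (blk_W _ _ (line_W hsp))
  have hs3r : (3 : ℝ) ≤ s := by exact_mod_cast hs3
  have hlog : 1 < Real.log (s : ℝ) := Literature.NumberTheory.Sieve.GreenTao2008.one_lt_log_of_three_le hs3r
  have hpow : 1 < Real.log (s : ℝ) ^ c := Real.one_lt_rpow hlog hc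
  push_cast at key
  have h1 : ((p : ℝ) + 1) * (s : ℝ) * 1 ≤ ((p : ℝ) + 1) * (s : ℝ) * Real.log (s : ℝ) ^ c := by
    apply mul_le_mul_of_nonneg_left hpow.le; positivity
  nlinarith


/-! ## Explicit constants -/


/-- The translate family at block size 3 in `ℤ/37`: `A_i = 9i + {0,1,2}`, `B_i = 9i + {0,3,6}`. -/
def tA37 : Fin 4 → Fin 3 → ZMod 37 := ![![0, 1, 2], ![9, 10, 11], ![18, 19, 20], ![27, 28, 29]]
/-- see `tA37`. -/
def tB37 : Fin 4 → Fin 3 → ZMod 37 := ![![0, 3, 6], ![9, 12, 15], ![18, 21, 24], ![27, 30, 33]]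

/-- `log 3 ≥ 2 − e/3 > 1.0939`. -/
lemma log_three_gt : (1.0939 : ℝ) < Real.log 3 := by
  have h1 : Real.log 3 = 1 + Real.log (3 / Real.exp 1) := by
    rw [Real.log_div (by norm_num) (Real.exp_pos 1).ne', Real.log_exp]; ring
  have h2 : 1 - (3 / Real.exp 1)⁻¹ ≤ Real.log (3 / Real.exp 1) :=
    Real.one_sub_inv_le_log_of_pos (by positivity)
  have h3 := Real.exp_one_lt_d9
  have h4 : (3 / Real.exp 1)⁻¹ = Real.exp 1 / 3 := by rw [inv_div]
  rw [h4] at h2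
  linarith

/-- Explicit constants are constrained from below by the translate family: `(c, s₀) = (13, 3)`
fails at `p = 37`, `n = 4`, `s = 3` (`4·3·(log 3)^13 ≥ 12·1.0939^13 > 37`).  For general `s` the
translates (`n = ⌊p/s²⌋`, density `≈ 1/s`) force `(log s)^c ≤ s` for every `s ≥ s₀`. -/
theorem not_primeLogDecayWith_13_3 : ¬ PrimeLogDecayWith 13 3 := by
  refine not_primeLogDecayWith_of_blocks (by norm_num) le_rfl tA37 tB37
    (by decide) (by decide) (by decide) (by decide) ?_
  have hlog := log_three_gt
  have hpow : (1.0939 : ℝ) ^ (13 : ℝ) < Real.log 3 ^ (13 : ℝ) :=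
    Real.rpow_lt_rpow (by norm_num) hlog (by norm_num)
  have hnum : (37 / 12 : ℝ) < (1.0939 : ℝ) ^ (13 : ℝ) := by
    rw [show (13 : ℝ) = (13 : ℕ) by norm_num, Real.rpow_natCast]
    norm_num
  push_cast
  linarith


/-! ## (f) Why translates cannot refute the crux: one translate class packs (`|S|·|A₀||B₀| ≤ |H|`)

If the blocks `A i = t i +ᵥ A₀`, `B i = u i +ᵥ B₀` (`i ∈ S`) are translates of ONE pair, (X) with
`j = i` makes the sets `u i + (A₀ + B₀)` pairwise disjoint and (W) makes `A₀ ⊕ B₀` direct, so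
`|S|·|A₀|·|B₀| ≤ |H|`: a family using `K` block shapes has `n s² ≤ K·|H|`, i.e. density `≤ K/s`.
Hence a counterexample to `PrimeLogDecay` must use `≥ s/(log s)^c` distinct block shapes. -/

section Translates
open scoped Pointwise
variable {G : Type*} [AddCommGroup G] [Fintype G] [DecidableEq G] {n : ℕ}

/-- One translate class of an SDPP family packs: `|S| · (|A₀| · |B₀|) ≤ |G|`. -/
theorem card_translateClass_mul_le {A B : Fin n → Finset G}
    (h : Literature.Computability.AlgebraicComplexity.IsSDPP A B)
    (S : Finset (Fin n)) (A₀ B₀ : Finset G) (t u : Fin n → G)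
    (hA : ∀ i ∈ S, A i = t i +ᵥ A₀) (hB : ∀ i ∈ S, B i = u i +ᵥ B₀) :
    S.card * (A₀.card * B₀.card) ≤ Fintype.card G := by
  classical
  have memA : ∀ i ∈ S, ∀ a ∈ A₀, t i + a ∈ A i := fun i hi a ha => by
    rw [hA i hi]; exact Finset.mem_vadd_finset.2 ⟨a, ha, rfl⟩
  have memB : ∀ i ∈ S, ∀ b ∈ B₀, u i + b ∈ B i := fun i hi b hb => by
    rw [hB i hi]; exact Finset.mem_vadd_finset.2 ⟨b, hb, rfl⟩
  let f : Fin n × (G × G) → G := fun x => u x.1 + x.2.1 + x.2.2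
  have hinj : Set.InjOn f ↑(S ×ˢ (A₀ ×ˢ B₀)) := by
    rintro ⟨i, a, b⟩ hx ⟨k, a', b'⟩ hy hxy
    simp only [Finset.coe_product, Set.mem_prod, Finset.mem_coe] at hx hy
    obtain ⟨hi, ha, hb⟩ := hx
    obtain ⟨hk, ha', hb'⟩ := hy
    simp only [f] at hxy
    -- (X) with j = i forces i = k
    have hik : i = k := by
      refine h.2 i i k (t i + a) (memA i hi a ha) (t i + a') (memA i hi a' ha')
        (u i + b) (memB i hi b hb) (u k + b') (memB k hk b' hb') ?_
      have e : (t i + a) - (t i + a') + ((u i + b) - (u k + b')) =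
          (u i + a + b) - (u k + a' + b') := by abel
      rw [e, hxy, sub_self]
    subst hik
    -- (W) for block i forces a = a', b = b'
    have e2 : (t i + a) - (t i + a') + ((u i + b) - (u i + b')) =
        (u i + a + b) - (u i + a' + b') := by abel
    have hW := h.1 i (t i + a) (memA i hi a ha) (t i + a') (memA i hi a' ha')
      (u i + b) (memB i hi b hb) (u i + b') (memB i hi b' hb') (by rw [e2, hxy, sub_self])
    obtain ⟨h1, h2⟩ := hW
    have ha_eq : a = a' := add_left_cancel h1
    have hb_eq : b = b' := add_left_cancel h2
    subst ha_eq; subst hb_eq; rfl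
  have hmaps : ∀ x ∈ S ×ˢ (A₀ ×ˢ B₀), f x ∈ (Finset.univ : Finset G) := fun _ _ =>
    Finset.mem_univ _
  have := Finset.card_le_card_of_injOn f hmaps hinj
  simpa [Finset.card_product, Finset.card_univ] using this

end Translates

end Summit.MatrixMultiplication.MatrixMultiplication.Theorems.PrimeLogDecay.Negative
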